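import Literature.NumberTheory.LFunctions.Zhang2022.Section7XiZeroSummable
import Literature.NumberTheory.LFunctions.Zhang2022.Section8Lemma84Steps
import Literature.NumberTheory.LFunctions.Zhang2022.SkeletonLemma84Rel
import HarnessLib

/-!
# Zhang (2022) §8, proof of Lemma 8.4: the contour-shift display `Z22:§8.u039` in the RELATIVE
# form, and its kernel equivalence with Lemma 8.4 (campaign layer L2, row 7 = `TypedSection08B`)

Topic `Literature/NumberTheory/LFunctions/Zhang2022` (Landau–Siegel audit tree; verdict-neutral).
Y. Zhang, *Discrete mean estimates and the Landau–Siegel zero*, arXiv:2211.02515v1 (2022)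
[Zhang2022LandauSiegel] — **an unrefereed manuscript under adjudication. The one `def … : Prop`
below is a CLAIM NODE, STATED NOT ASSERTED**; nothing here asserts or denies Theorems 1–2 of the
source, and typed ≠ discharged.

Why this file exists (GAP row G-adj1-1, TEAM A 2026-08-26; same root as G-d55-3): the display
`Z22:§8.u039` [Z22 p.47, tex L2413–L2418] — "Combining these results with Lemma 8.3, we find that the
integral (8.9) is equal to `L′(1,χ)Π(d,r)·(1/2πi)∫_{|s|=5α}(s+β_{j+1})(s+β_{j+2})s⁻¹x^s(s+β_μ)⁻² ds
+ O(𝓛⁻⁶)`" — is typed AS PRINTED, with an ABSOLUTE implied constant, as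
`Typed.S8B.Integral89MainTerm c′` (`TypedSection08B`, p412401). The printed contour argument does not
deliver an absolute constant: on `|s| = 5α` the `O(𝓛⁻¹⁵)` of `Z22:§8.u038` is multiplied by
`𝓤_j(d,r;1+s) ≈ Π(d,r)` and by the circle factor `≍ α⁻¹ ≍ 𝓛⁹`, and `sup_{dr<PT⁻²}|Π(d,r)|` is
unbounded in `D`. The derivable statement carries the factor `∏_{q∣dr}(1 − q⁻¹)⁻²` — exactly the
factor of the banked relative Lemma 8.4, `Skeleton.Lemma84Rel c′` (`SkeletonLemma84Rel`). This file
types that relative display, `Integral89MainTermRel c′` (the "decl WANTED" of G-adj1-1), and proves in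
the kernel:

* `integral89MainTermRel_of_integral89MainTerm` — absolute ⇒ relative (the factor is `≥ 1`);
* `lemma84Rel_of : Sum84EqLineIntegral c′ → Integral89MainTermRel c′ → Skeleton.Lemma84Rel c′` — the
  "direct calculation" closing the proof of Lemma 8.4 (tree `circleIntegral_lemma84`:
  `(1/2πi)∮_{|s|=5α}(s+β_{j+1})(s+β_{j+2})x^s s⁻¹(s+β_μ)⁻² ds = 𝓖_{jμ}(x)`), relative version of
  `Typed.S8B.lemma84_of`;
* the converse `integral89MainTermRel_of_lemma84Rel`, and — since (8.9) is now a theorem of the tree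
  for every modulus (`XiZeroSummable.sum84EqLineIntegral_holds`, sz-d21 p415427) — the UNCONDITIONAL
  equivalences `integral89MainTermRel_iff_lemma84Rel : Integral89MainTermRel c′ ↔ Lemma84Rel c′` and
  `integral89MainTerm_iff_lemma84 : Integral89MainTerm c′ ↔ Lemma84 c′`: the typed display
  `Z22:§8.u039` (resp. its relative repair) is kernel-equivalent to the leaf Lemma 8.4 (resp. to the
  whole-DAG `v8` leaf `Lemma84Rel`);
* `Ded84Rel` — the proof node `Z22:Lem8.4.pf` re-pointed to the relative inputs ((8.9), Lemma 8.3 in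
  the relative form `Skeleton.Lemma83Rel`, `Z22:§8.u038`, `Integral89MainTermRel` ⊢ `Lemma84Rel`) —
  and `ded84Rel_holds`.

What is NOT here: any proof of the contour shift itself (`Integral89MainTermRel` from `Lemma83Rel`
and `Z22:§8.u038`; that is the discharge of the leaf `Lemma84Rel`, in progress elsewhere in the
tree), Lemma 8.3 / Appendix A, or anything about Theorems 1–2 of the source.

## References

* Y. Zhang, arXiv:2211.02515v1 (2022), §8 Lemma 8.4 and its proof, pp. 46–47, tex L2392–L2418;
  (8.9) p.46. [cite: Zhang2022LandauSiegel, §8 pp. 46–47]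
-/

noncomputable section

open Complex Real
open Literature.NumberTheory.LFunctions.Zhang2022.Skeleton

namespace Literature.NumberTheory.LFunctions.Zhang2022.Typed.S8B

section Claim

variable (c' : ℝ)

/-- **`Z22:§8.u039`, relative form** [Z22 p.47, tex L2414] (GAP row G-adj1-1, the derivable
statement): under (A), for `D` large, `1 ≤ j ≤ 3`, `μ ∈ {6,7}`, `dr < PT⁻²`, `T < x < P`,
`|(1/2πi)∫_{(1)} (Σ_n χ(n)ξ₀ⱼ(n;d,r)n^{−(1+s)}) x^s ds/(s+β_μ)²
  − L′(1,χ)Π(d,r)·(1/2πi)∫_{|s|=5α}(s+β_{j+1})(s+β_{j+2})s⁻¹x^s(s+β_μ)⁻² ds|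
  ≤ C𝓛⁻⁶·(∏_{q∣dr}(1 − q⁻¹)⁻¹)²` — the typed display `Integral89MainTerm c′` verbatim except for the
factor `(∏_{q∣dr}(1 − q⁻¹)⁻¹)²` (the factor of `Skeleton.Lemma84Rel`). CLAIM, stated not asserted.
[cite: Zhang2022LandauSiegel, §8 proof of Lemma 8.4 p.47] -/
def Integral89MainTermRel : Prop :=
  ∃ C : ℝ, ForAllLarge fun D _ χ => AssumptionA D χ →
    ∀ j ∈ ({1, 2, 3} : Finset ℕ), ∀ μ ∈ ({6, 7} : Finset ℕ), ∀ d r : ℕ, 1 ≤ d → 1 ≤ r →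
      ((d * r : ℕ) : ℝ) < bigP D / bigT D ^ 2 → ∀ x : ℝ, bigT D < x → x < bigP D →
        ‖vlineInt 1 (fun s => xiSeries c' χ j d r (1 + s) * (x : ℂ) ^ s / (s + betaMu D μ) ^ 2) -
            deriv χ.LFunction 1 * PiW χ d r * circInt (5 * alpha D) (fun s =>
              (s + betaJ c' D (j + 1)) * (s + betaJ c' D (j + 2)) * (x : ℂ) ^ s /
                (s * (s + betaMu D μ) ^ 2))‖ ≤
          C * (ell D ^ 6)⁻¹ * (∏ q ∈ (d * r).primeFactors, (1 - (q : ℝ)⁻¹)⁻¹) ^ 2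

/-- **`Z22:Lem8.4.pf`, relative re-pointing** [Z22 pp.46–47, tex L2401–L2417]: the manuscript's proof
of Lemma 8.4 read with the relative inputs — (8.9), Lemma 8.3 in the relative form
`Skeleton.Lemma83Rel` (row G-d55-3), "By Lemma 5.5 and 5.6" (`LQuotientOnCircle`), the moved contour
in the relative form (`Integral89MainTermRel`), "direct calculation" ⊢ `Skeleton.Lemma84Rel`.
CLAIM(proof); PROVED below (`ded84Rel_holds`). [cite: Zhang2022LandauSiegel, §8 proof of Lemma 8.4 pp.46–47] -/
def Ded84Rel : Prop :=
  Sum84EqLineIntegral c' → Lemma83Rel c' → LQuotientOnCircle c' → Integral89MainTermRel c' →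
    Lemma84Rel c'

end Claim

section Edges

variable (c' : ℝ)

/-- **EDGE** absolute ⇒ relative: the display `Z22:§8.u039` as printed implies its relative form
(`(∏_{q∣dr}(1 − q⁻¹)⁻¹)² ≥ 1`). PROVED. [cite: Zhang2022LandauSiegel, §8 proof of Lemma 8.4 p.47] -/
theorem integral89MainTermRel_of_integral89MainTerm (h : Integral89MainTerm c') :
    Integral89MainTermRel c' := by
  obtain ⟨C, hC⟩ := h
  refine ⟨|C|, hC.mono fun D _ χ _ _ hS hA j hj μ hμ d r hd hr hdr x hx1 hx2 => ?_⟩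
  -- `1 ≤ ∏_{q∣dr}(1 − q⁻¹)⁻¹` (each prime `q ≥ 2`); inlined as in `Skeleton.lemma84Rel_of_lemma84`
  -- (a standalone copy would restate `GreenTao2008.GYCorr.one_le_prod_one_sub_inv_inv`).
  have hprod : 1 ≤ ∏ q ∈ (d * r).primeFactors, (1 - (q : ℝ)⁻¹)⁻¹ := by
    refine le_of_eq_of_le (Finset.prod_const_one (s := (d * r).primeFactors)).symm
      (Finset.prod_le_prod (fun _ _ => zero_le_one) fun q hq => ?_)
    have hq2 : (2 : ℝ) ≤ q := by exact_mod_cast (Nat.prime_of_mem_primeFactors hq).two_le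
    have h1 : 0 < 1 - (q : ℝ)⁻¹ := by
      have : (q : ℝ)⁻¹ ≤ 1 / 2 := by rw [inv_eq_one_div]; gcongr
      linarith
    have h2 : 1 - (q : ℝ)⁻¹ ≤ 1 := by
      have : 0 ≤ (q : ℝ)⁻¹ := by positivity
      linarith
    exact (one_le_inv₀ h1).mpr h2
  have hℓ : 0 ≤ (ell D ^ 6)⁻¹ := by positivity
  calc _ ≤ C * (ell D ^ 6)⁻¹ := hS hA j hj μ hμ d r hd hr hdr x hx1 hx2
    _ ≤ |C| * (ell D ^ 6)⁻¹ := by gcongr; exact le_abs_self _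
    _ = |C| * (ell D ^ 6)⁻¹ * 1 ^ 2 := by ring
    _ ≤ |C| * (ell D ^ 6)⁻¹ * (∏ q ∈ (d * r).primeFactors, (1 - (q : ℝ)⁻¹)⁻¹) ^ 2 := by
        gcongr

/-- The "direct calculation" of Lemma 8.4 [Z22 p.47, tex L2417], kernel form: for `D ≥ 3` and
`x > 0`, `(1/2πi)∮_{|s|=5α}(s+β_{j+1})(s+β_{j+2})x^s s⁻¹(s+β_μ)⁻² ds = 𝓖_{jμ}(x)` (tree
`circleIntegral_lemma84`; the poles `0`, `−β_μ` lie inside `|s| = 5α`, `β_μ ≠ 0`).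
[cite: Zhang2022LandauSiegel, §8 proof of Lemma 8.4 p.47] -/
theorem circInt84_eq_frakgW {D : ℕ} (hD : 3 ≤ D) (j μ : ℕ) {x : ℝ} (hx : 0 < x) :
    circInt (5 * alpha D) (fun s =>
        (s + betaJ c' D (j + 1)) * (s + betaJ c' D (j + 2)) * (x : ℂ) ^ s /
          (s * (s + betaMu D μ) ^ 2)) = frakgW c' D j μ x := by
  have hα : 0 < alpha D := alpha_pos hD
  have hxs : ∀ s : ℂ, (x : ℂ) ^ s = cexp (s * (Real.log x : ℂ)) := fun s => by
    rw [Complex.cpow_def_of_ne_zero (Complex.ofReal_ne_zero.mpr hx.ne'), ← Complex.ofReal_log hx.le,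
      mul_comm]
  simp only [circInt, hxs, frakgW]
  refine circleIntegral_lemma84 _ _ _ _ (Metric.mem_ball_self (mul_pos (by norm_num) hα)) ?_
    (betaMu_ne_zero hα μ)
  rw [Metric.mem_ball, dist_zero_right, norm_neg]; exact norm_betaMu_lt hα μ

/-- **EDGE** (the "direct calculation" of Lemma 8.4 in the relative form, kernel-checked): (8.9) and
the relative display `Integral89MainTermRel` ⟹ `Skeleton.Lemma84Rel`. PROVED (relative version of
`lemma84_of`). [cite: Zhang2022LandauSiegel, §8 proof of Lemma 8.4 p.47] -/
theorem lemma84Rel_of (h89 : Sum84EqLineIntegral c') (h839 : Integral89MainTermRel c') :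
    Lemma84Rel c' := by
  obtain ⟨C, D₀, hD⟩ := h839
  refine ⟨C, max D₀ 3, fun D _ χ hDle hq hp hA j hj μ hμ d r hd hr hdr x hTx hxP => ?_⟩
  have hD3 : 3 ≤ D := le_trans (le_max_right _ _) hDle
  have hx : 0 < x := lt_trans (by unfold bigT; positivity) hTx
  have key := hD D χ (le_trans (le_max_left _ _) hDle) hq hp hA j hj μ hμ d r hd hr hdr x hTx hxP
  change ‖sum84 c' χ j μ d r x - deriv χ.LFunction 1 * PiW χ d r * frakgW c' D j μ x‖ ≤
    C * (ell D ^ 6)⁻¹ * (∏ q ∈ (d * r).primeFactors, (1 - (q : ℝ)⁻¹)⁻¹) ^ 2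
  rw [h89 D χ j hj μ hμ d r hd hr hdr x hTx hxP, ← circInt84_eq_frakgW c' hD3 j μ hx]
  exact key

/-- **EDGE** (converse): (8.9) and the relative Lemma 8.4 ⟹ the relative display
`Integral89MainTermRel` (the same "direct calculation" read backwards). PROVED.
[cite: Zhang2022LandauSiegel, §8 proof of Lemma 8.4 p.47] -/
theorem integral89MainTermRel_of_lemma84Rel (h89 : Sum84EqLineIntegral c') (h84 : Lemma84Rel c') :
    Integral89MainTermRel c' := by
  obtain ⟨C, D₀, hD⟩ := h84
  refine ⟨C, max D₀ 3, fun D _ χ hDle hq hp hA j hj μ hμ d r hd hr hdr x hTx hxP => ?_⟩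
  have hD3 : 3 ≤ D := le_trans (le_max_right _ _) hDle
  have hx : 0 < x := lt_trans (by unfold bigT; positivity) hTx
  have key := hD D χ (le_trans (le_max_left _ _) hDle) hq hp hA j hj μ hμ d r hd hr hdr x hTx hxP
  rw [← h89 D χ j hj μ hμ d r hd hr hdr x hTx hxP, circInt84_eq_frakgW c' hD3 j μ hx]
  exact key

/-- **EDGE** (converse, absolute form): (8.9) and Lemma 8.4 as banked ⟹ the display `Z22:§8.u039`
as typed. PROVED. [cite: Zhang2022LandauSiegel, §8 proof of Lemma 8.4 p.47] -/
theorem integral89MainTerm_of_lemma84 (h89 : Sum84EqLineIntegral c') (h84 : Lemma84 c') :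
    Integral89MainTerm c' := by
  obtain ⟨C, D₀, hD⟩ := h84
  refine ⟨C, max D₀ 3, fun D _ χ hDle hq hp hA j hj μ hμ d r hd hr hdr x hTx hxP => ?_⟩
  have hD3 : 3 ≤ D := le_trans (le_max_right _ _) hDle
  have hx : 0 < x := lt_trans (by unfold bigT; positivity) hTx
  have key := hD D χ (le_trans (le_max_left _ _) hDle) hq hp hA j hj μ hμ d r hd hr hdr x hTx hxP
  rw [← h89 D χ j hj μ hμ d r hd hr hdr x hTx hxP, circInt84_eq_frakgW c' hD3 j μ hx]
  exact key

/-- **`Z22:§8.u039` (relative) ⟺ the `v8` leaf `Skeleton.Lemma84Rel`**, unconditionally: (8.9) is a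
theorem of the tree for every modulus (`XiZeroSummable.sum84EqLineIntegral_holds`). PROVED.
[cite: Zhang2022LandauSiegel, §8 proof of Lemma 8.4 pp.46–47] -/
theorem integral89MainTermRel_iff_lemma84Rel : Integral89MainTermRel c' ↔ Lemma84Rel c' :=
  ⟨lemma84Rel_of c' (XiZeroSummable.sum84EqLineIntegral_holds c'),
    integral89MainTermRel_of_lemma84Rel c' (XiZeroSummable.sum84EqLineIntegral_holds c')⟩

/-- **`Z22:§8.u039` (as printed) ⟺ the banked leaf `Skeleton.Lemma84`**, unconditionally. PROVED.
[cite: Zhang2022LandauSiegel, §8 proof of Lemma 8.4 pp.46–47] -/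
theorem integral89MainTerm_iff_lemma84 : Integral89MainTerm c' ↔ Lemma84 c' :=
  ⟨XiZeroSummable.lemma84_of_integral89MainTerm c',
    integral89MainTerm_of_lemma84 c' (XiZeroSummable.sum84EqLineIntegral_holds c')⟩

/-- **`Lemma84Rel` reduced to its contour-shift display**: the `v8` leaf follows from the relative
display `Z22:§8.u039` alone. PROVED. [cite: Zhang2022LandauSiegel, §8 proof of Lemma 8.4 p.47] -/
theorem lemma84Rel_of_integral89MainTermRel (h : Integral89MainTermRel c') : Lemma84Rel c' :=
  (integral89MainTermRel_iff_lemma84Rel c').mp h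

/-- **`Z22:Lem8.4.pf` (relative re-pointing) HOLDS**: `Ded84Rel` is a theorem of the kernel (the
inputs Lemma 8.3 (relative) and `Z22:§8.u038` enter only through `Integral89MainTermRel`).
[cite: Zhang2022LandauSiegel, §8 proof of Lemma 8.4 pp.46–47] -/
theorem ded84Rel_holds : Ded84Rel c' := fun h89 _ _ h839 => lemma84Rel_of c' h89 h839

/-- `Ded84Rel` — `_holds` alias of `ded84Rel_holds` above under the fact's exact name (appended
2026-08-28, D-0026 bookkeeping: the proof term is the existing theorem of this file; no statement,
definition or attribute is edited; no new named fact; the ledger's debt table listed the fact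
unproved). [cite: Zhang2022LandauSiegel, §8 proof of Lemma 8.4 pp.46–47] -/
theorem _root_.Literature.NumberTheory.LFunctions.Zhang2022.Typed.S8B.Ded84Rel_holds :
    Ded84Rel c' :=
  _root_.Literature.NumberTheory.LFunctions.Zhang2022.Typed.S8B.ded84Rel_holds (c' := c')

/-- The inputs of `Ded84Rel` other than the contour shift are theorems of the tree: (8.9)
(`XiZeroSummable.sum84EqLineIntegral_holds`) and `Z22:§8.u038`
(`Section8Lemma84Steps.lQuotientOnCircle_holds`); hence `Lemma84Rel` hangs on
`Lemma83Rel → Integral89MainTermRel` alone. PROVED. [cite: Zhang2022LandauSiegel, §8 proof of Lemma 8.4 pp.46–47] -/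
theorem lemma84Rel_of_relStep (h : Lemma83Rel c' → Integral89MainTermRel c') (h83 : Lemma83Rel c') :
    Lemma84Rel c' :=
  ded84Rel_holds c' (XiZeroSummable.sum84EqLineIntegral_holds c') h83
    (Section8Lemma84Steps.lQuotientOnCircle_holds c') (h h83)

end Edges

end Literature.NumberTheory.LFunctions.Zhang2022.Typed.S8B
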